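import Mathlib.Analysis.InnerProductSpace.NormDet
import Mathlib.Analysis.Normed.Operator.NNNorm
import HarnessLib

/-!
# Gram determinants do not grow under contractions: `normDet (g ∘ f) ≤ ‖g‖^{dim U} · normDet f`
# (seat ym-line-ftr-p1 g7; helper toward crux K1 `NearFlatRatioLaw` stmt-QuantumFields-24720, line «borate», the RATE twin of `stub_boRate`;
# design note `Cruxes/NearFlatRatioLaw/Lines/borate-rate-uniformity-g7.md`)

In the Born–Oppenheimer data with rate (`BORateAll`, FCL 23943 / FTR 24720) the dressing cost (P6) `‖g‖² ≤ e^{C u²}‖φ‖²` must hold for EVERY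
family supported in the inner region `orbitDist < β^{-1/40}`, where the slow variable `c` reaches far beyond its natural scale `u = λ_b(L³β)`.
Two true-vs-model factors grow like `|c|²` there and therefore cannot be bounded by `C u²`; they must be CARRIED in the one-site comparison
function with their SIGN.  One is the stiff zero-point shift (toron minimality, RED `sum_modeZPE_ge_vacuum_add_gain_of_near`).  The other is the
Faddeev–Popov mismatch between the slice normalisation `N = gaugeAvg χ ∝ 1/normDet(P_Γ ∘ D_u|based)` of lane A's weight of record
(`…TwistedTraceScalingFPWeightLaplace`, projection `P_Γ` onto the vacuum gauge modes) and the kinetic Faddeev–Popov factor of the averaged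
kernel, `∝ 1/normDet(D_u|based)` (no projection).  This file proves the one abstract inequality that fixes the SIGN of that mismatch:

* ★ `normDet_comp_le` — for linear `f : U → V` and continuous linear `g : V → W` between finite-dimensional real inner product spaces,
  `normDet (g ∘ f) ≤ ‖g‖ ^ finrank U · normDet f` (proof: `μH[dim U]`-volume of the image of a ball, Mathlib's `LinearMap.hausdorffMeasure_image`,
  and the Lipschitz bound `LipschitzWith.hausdorffMeasure_image_le`);
* ★ `normDet_comp_le_of_opNorm_le_one` — a contraction (in particular an orthogonal projection, `normDet_starProjection_comp_le`) can only
  DECREASE the Gram determinant: `normDet (P ∘ f) ≤ normDet f`;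
* `inv_normDet_le_inv_normDet_comp` — hence the Gaussian volumes `(π s²)^{d/2}/normDet` compare the other way:
  `1/normDet f ≤ 1/normDet (P ∘ f)` whenever `P ∘ f` is injective — the projected (slice) normalisation DOMINATES the kinetic one, i.e. the
  mismatch ratio `r = normDet(P∘f)/normDet(f) ≤ 1` acts as an additional CONFINING weight, with the same sign as toron minimality.

HONEST FRAMING: finite-dimensional linear algebra (folklore); a helper for the stub of a crux of the CONDITIONAL femto route R2b1 (RECORD rung);
nothing here is infinite volume, a mass gap or Clay.  No summit statement is proved.
-/

set_option autoImplicit false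

noncomputable section

open MeasureTheory Module

namespace Summit.QuantumFields.YangMills.Theorems.FemtoTransferGap.FibredBO

variable {U V W : Type*} [NormedAddCommGroup U] [InnerProductSpace ℝ U] [FiniteDimensional ℝ U]
  [NormedAddCommGroup V] [InnerProductSpace ℝ V] [NormedAddCommGroup W] [InnerProductSpace ℝ W]

/-- ★ **Gram determinants do not grow under bounded maps**: `normDet (g ∘ f) ≤ ‖g‖ ^ finrank U · normDet f`.
Proof: compare the `finrank U`-dimensional Hausdorff measures of the images of the unit ball (`LinearMap.hausdorffMeasure_image`) using the
Lipschitz constant `‖g‖₊` of `g` (`LipschitzWith.hausdorffMeasure_image_le`). [folklore] -/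
theorem normDet_comp_le (f : U →ₗ[ℝ] V) (g : V →L[ℝ] W) :
    ((g : V →ₗ[ℝ] W) ∘ₗ f).normDet ≤ ‖g‖ ^ finrank ℝ U * f.normDet := by
  borelize U V W
  set d := finrank ℝ U with hd
  set s : Set U := Metric.closedBall (0 : U) 1 with hs
  have hs_pos : 0 < μH[d] s := by
    refine Measure.measure_pos_of_nonempty_interior _ ?_
    rw [hs, interior_closedBall (0 : U) one_ne_zero]
    exact ⟨0, Metric.mem_ball_self one_pos⟩
  have hs_top : μH[d] s < ⊤ := (isCompact_closedBall (0 : U) 1).measure_lt_top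
  -- the two image identities and the Lipschitz bound
  have h1 : μH[d] (((g : V →ₗ[ℝ] W) ∘ₗ f) '' s) = ENNReal.ofReal ((g : V →ₗ[ℝ] W) ∘ₗ f).normDet * μH[d] s :=
    LinearMap.hausdorffMeasure_image _ s
  have h2 : μH[d] (f '' s) = ENNReal.ofReal f.normDet * μH[d] s := LinearMap.hausdorffMeasure_image f s
  have h3 : μH[d] (g '' (f '' s)) ≤ (‖g‖₊ : ENNReal) ^ (d : ℝ) * μH[d] (f '' s) :=
    g.lipschitz.hausdorffMeasure_image_le (by positivity) (f '' s)
  have himg : ((g : V →ₗ[ℝ] W) ∘ₗ f) '' s = g '' (f '' s) := by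
    rw [Set.image_image]; rfl
  rw [himg] at h1
  rw [h1, h2, ENNReal.rpow_natCast, ← mul_assoc] at h3
  -- cancel the positive finite factor `μH[d] s`
  have h4 : ENNReal.ofReal ((g : V →ₗ[ℝ] W) ∘ₗ f).normDet ≤ (‖g‖₊ : ENNReal) ^ d * ENNReal.ofReal f.normDet :=
    (ENNReal.mul_le_mul_iff_left hs_pos.ne' hs_top.ne).mp h3
  have h5 : (‖g‖₊ : ENNReal) ^ d * ENNReal.ofReal f.normDet = ENNReal.ofReal (‖g‖ ^ d * f.normDet) := by
    rw [ENNReal.ofReal_mul (by positivity), ENNReal.ofReal_pow (norm_nonneg _), ← coe_nnnorm g, ENNReal.ofReal_coe_nnreal]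
  rw [h5] at h4
  exact (ENNReal.ofReal_le_ofReal_iff (mul_nonneg (pow_nonneg (norm_nonneg _) _) f.normDet_nonneg)).mp h4

/-- ★ **A contraction can only decrease the Gram determinant**: `‖g‖ ≤ 1 ⇒ normDet (g ∘ f) ≤ normDet f`. [folklore] -/
theorem normDet_comp_le_of_opNorm_le_one (f : U →ₗ[ℝ] V) (g : V →L[ℝ] W) (hg : ‖g‖ ≤ 1) :
    ((g : V →ₗ[ℝ] W) ∘ₗ f).normDet ≤ f.normDet := by
  refine (normDet_comp_le f g).trans ?_
  have h1 : ‖g‖ ^ finrank ℝ U ≤ 1 := pow_le_one₀ (norm_nonneg _) hg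
  have h2 : 0 ≤ f.normDet := f.normDet_nonneg
  nlinarith

/-- ★ **Orthogonal projections decrease Gram determinants**: for a complete subspace `K` of `V`,
`normDet (P_K ∘ f) ≤ normDet f` (`P_K = K.starProjection`, `‖P_K‖ ≤ 1`).  This is the SIGN of the Faddeev–Popov mismatch of the rate twin: the slice
normalisation built with the vacuum-gauge projection `P_Γ` has the SMALLER Gram determinant, hence the LARGER Gaussian volume. [folklore] -/
theorem normDet_starProjection_comp_le (f : U →ₗ[ℝ] V) (K : Submodule ℝ V) [K.HasOrthogonalProjection] :
    ((K.starProjection : V →ₗ[ℝ] V) ∘ₗ f).normDet ≤ f.normDet :=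
  normDet_comp_le_of_opNorm_le_one f K.starProjection (Submodule.starProjection_norm_le K)

/-- **Gaussian volumes compare the other way.**  If `g ∘ f` is injective and `‖g‖ ≤ 1` then `1/normDet f ≤ 1/normDet (g ∘ f)`: with
`∫ exp(−‖A v‖²/s²) dv = (π s²)^{d/2}/normDet A` (`…TwistedTraceScalingGaussianLinear`), the Gaussian volume of the contracted quadratic form
dominates.  (Injectivity of `g ∘ f` makes both Gram determinants positive.) [folklore] -/
theorem inv_normDet_le_inv_normDet_comp (f : U →ₗ[ℝ] V) (g : V →L[ℝ] W) (hg : ‖g‖ ≤ 1)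
    (hinj : Function.Injective ((g : V →ₗ[ℝ] W) ∘ₗ f)) :
    (f.normDet)⁻¹ ≤ (((g : V →ₗ[ℝ] W) ∘ₗ f).normDet)⁻¹ := by
  have hpos : 0 < ((g : V →ₗ[ℝ] W) ∘ₗ f).normDet := by
    rcases (LinearMap.normDet_nonneg ((g : V →ₗ[ℝ] W) ∘ₗ f)).lt_or_eq with h | h
    · exact h
    · exfalso
      have hk := LinearMap.normDet_eq_zero_iff_ker_ne_bot.mp h.symm
      exact hk (LinearMap.ker_eq_bot.mpr hinj)
  exact inv_anti₀ hpos (normDet_comp_le_of_opNorm_le_one f g hg)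

/-- The mismatch RATIO `r := normDet (g ∘ f) / normDet f` of a contraction lies in `[0, 1]` (when `f` is injective; for non-injective `f` both
determinants vanish and Lean's `0/0 = 0`).  In the rate twin `√r(c)` multiplies the one-site comparison function `g = f·√λ·√r`, so (P6) reads
`‖g‖² = ∫ f² λ r ≤ (sup λ)·‖f‖²` with NO flatness of the Faddeev–Popov normalisation in the slow variable. [folklore] -/
theorem normDet_comp_div_mem_Icc (f : U →ₗ[ℝ] V) (g : V →L[ℝ] W) (hg : ‖g‖ ≤ 1) :
    ((g : V →ₗ[ℝ] W) ∘ₗ f).normDet / f.normDet ∈ Set.Icc (0 : ℝ) 1 := by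
  refine ⟨div_nonneg (LinearMap.normDet_nonneg _) (LinearMap.normDet_nonneg _), ?_⟩
  rcases (LinearMap.normDet_nonneg f).lt_or_eq with h | h
  · exact (div_le_one h).mpr (normDet_comp_le_of_opNorm_le_one f g hg)
  · rw [← h, div_zero]; exact zero_le_one

end Summit.QuantumFields.YangMills.Theorems.FemtoTransferGap.FibredBO

end
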